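import Literature.AlgebraicGeometry.Resolution.LocalBlowup
import HarnessLib

/-!
# Denominators of the local rings of models: `b = D · Q · y` with `b` in the base

Topic: `Literature/AlgebraicGeometry/Resolution` (proofs only; no new notions, no new named
facts). Bookkeeping for Cossart–Piltant 2019's descent from the formal completion (J. Algebra
529 (2019) = arXiv:1412.0868, proof of Prop. 4.8, (510)–(512), arXiv v1 Prop. 4.6 p. 53): the
local ring `𝒪_{Ŷ,ŷ}` of the model `Ŷ → Spec Â`, which is an isomorphism above `Spec Â_g`, is the
localization of a finitely generated `Â`-algebra `Â[z₁, …, z_n]` whose generators have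
denominators `a_i` dividing a power of `g` (so, at the end of Lemma 4.7, units times monomials in
`û₁, …, û_r`). Consequently EVERY element `y` of `𝒪_{Ŷ,ŷ}` — in particular each complementary
regular parameter — satisfies `b = D · Q · y` with `b ∈ Â`, `D` a product of the `a_i` and `Q` a
unit of the local ring: the input "elements of `Â` of the shape `unit · monomial · parameter`" of
the density step (512) (`exists_rsp_powers_of_cp511_of_shape`,
`ArithmeticalThreefoldsDensity512.lean`).

* `exists_mul_mem_range_of_mem_adjoin_of_denominators` — for `P ∈ S[t]`: `a · P ∈ S` for some
  `a ∈ S` whose image lies in a given submonoid `M` containing the denominators;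
* `exists_mul_mul_mem_range_of_mem_locAtCentre_of_denominators` — for `y ∈ (S[t])_𝔪`:
  `a · Q · y ∈ S` with `a` as above and `Q ∈ S[t]` of value `0`.

Both for an arbitrary base `S → E` (a TYPE with `algebraMap S E`, as in the frame of the
monoidal engines; neither injectivity nor any property of `S` is used) and an arbitrary submonoid
`M` of admissible multipliers.

## Sources

* V. Cossart, O. Piltant, J. Algebra 529 (2019) 268–535 = arXiv:1412.0868, proof of Prop. 4.8,
  (510)–(512) (arXiv v1: Prop. 4.6, p. 53). [CossartPiltant2019]
-/

noncomputable section

namespace Literature.AlgebraicGeometry.Resolution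

universe u v

section Denominators

variable {S : Type u} [CommRing S] {E : Type v} [Field E] [Algebra S E]

/-- **Clearing denominators in `S[t]`.** If every generator `z ∈ t` satisfies `a_z · z ∈ S`
(images in `E`) for some `a_z ∈ S` whose image lies in the submonoid `M`, then every element `P`
of `S[t] = Algebra.adjoin S t` satisfies `a · P ∈ S` for some `a ∈ S` with image in `M`
(induction on `P`: products of the `a_z`) — the bookkeeping of the denominators of the model
`Â[z₁, …, z_n]` in Cossart–Piltant's (510).
[cite: CossartPiltant2019, proof of Prop. 4.8, (510) (arXiv v1: Prop. 4.6, p. 53)] -/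
theorem exists_mul_mem_range_of_mem_adjoin_of_denominators (t : Set E) (M : Submonoid E)
    (hden : ∀ z ∈ t, ∃ a : S, algebraMap S E a ∈ M ∧ ∃ b : S, algebraMap S E a * z = algebraMap S E b)
    {P : E} (hP : P ∈ Algebra.adjoin S t) :
    ∃ a : S, algebraMap S E a ∈ M ∧ ∃ b : S, algebraMap S E a * P = algebraMap S E b := by
  induction hP using Algebra.adjoin_induction with
  | mem z hz => exact hden z hz
  | algebraMap s => exact ⟨1, by rw [map_one]; exact M.one_mem, s, by rw [map_one, one_mul]⟩
  | add P P' _ _ ih ih' =>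
    obtain ⟨a, haM, b, hab⟩ := ih
    obtain ⟨a', ha'M, b', hab'⟩ := ih'
    refine ⟨a * a', by rw [map_mul]; exact M.mul_mem haM ha'M, a' * b + a * b', ?_⟩
    rw [map_mul, mul_add, map_add, map_mul, map_mul, ← hab, ← hab']
    ring
  | mul P P' _ _ ih ih' =>
    obtain ⟨a, haM, b, hab⟩ := ih
    obtain ⟨a', ha'M, b', hab'⟩ := ih'
    refine ⟨a * a', by rw [map_mul]; exact M.mul_mem haM ha'M, b * b', ?_⟩
    rw [map_mul, map_mul, ← hab, ← hab']
    ring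

/-- **Clearing denominators in the local ring `(S[t])_𝔪 = locAtCentre (S[t]) O`.** Under the
same hypothesis, every `y ∈ locAtCentre (S[t]) O` satisfies `a · Q · y ∈ S` (images in `E`) for
some `a ∈ S` with image in `M` and some `Q ∈ S[t]` with `O.valuation Q = 1` (a unit of the local
ring when `S[t] ⊆ O`). In Cossart–Piltant 2019: every element of `𝒪_{Ŷ,ŷ}`, in particular each
regular parameter, is `b / (D Q)` with `b ∈ Â`, `D` a product of the denominators of the model
(dividing a power of `g`) and `Q` a unit.
[cite: CossartPiltant2019, proof of Prop. 4.8, (510)–(512) (arXiv v1: Prop. 4.6, p. 53)] -/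
theorem exists_mul_mul_mem_range_of_mem_locAtCentre_of_denominators (O : ValuationSubring E)
    (t : Set E) (M : Submonoid E)
    (hden : ∀ z ∈ t, ∃ a : S, algebraMap S E a ∈ M ∧ ∃ b : S, algebraMap S E a * z = algebraMap S E b)
    {y : E} (hy : y ∈ locAtCentre (Algebra.adjoin S t).toSubring O) :
    ∃ (a : S) (Q : E), algebraMap S E a ∈ M ∧ Q ∈ Algebra.adjoin S t ∧ O.valuation Q = 1 ∧
      ∃ b : S, algebraMap S E a * Q * y = algebraMap S E b := by
  obtain ⟨P, hP, Q, hQ, hvQ, rfl⟩ := hy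
  obtain ⟨a, haM, b, hab⟩ :=
    exists_mul_mem_range_of_mem_adjoin_of_denominators t M hden (P := P) hP
  refine ⟨a, Q, haM, hQ, hvQ, b, ?_⟩
  have hQ0 : Q ≠ 0 := ne_zero_of_valuation_eq_one hvQ
  rw [← hab, mul_assoc, mul_div_cancel₀ _ hQ0]

end Denominators

end Literature.AlgebraicGeometry.Resolution

end
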